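import Summits.ResolutionOfSingularities.ResolutionOfSingularities.Theorems.MarkedTransferCampaignW46MohWindowShadeFormalNRStepCore
import Summits.ResolutionOfSingularities.ResolutionOfSingularities.Theorems.MarkedTransferCampaignW46WWalkStepForms
import Summits.ResolutionOfSingularities.ResolutionOfSingularities.Theorems.MarkedTransferCampaignW46WWalkNRBaseChange
import Summits.ResolutionOfSingularities.ResolutionOfSingularities.Theorems.MarkedTransferCampaignW46WWalkNRHensel
import HarnessLib

/-!
# [OURS · L1 W4.6 rung (iii-2), NON-RATIONAL W-WALK over an ARBITRARY ground field, brick 12] The controlled transform of a `w`-anchor at a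
# NON-RATIONAL point with SEPARABLE minimal polynomial (ring level; brick 3 with the perfectness of `K₀` replaced by a separability INPUT)

Cell `res-hironaka`, LADDER-RESOLUTION rung L (D-0089), slot W4.6 rung (iii); seat res-L1-s46-pv-6 (gen 8). Host route MarkedTransfer,
`--supports stmt-ResolutionOfSingularities-16155 --as helper`; kind proof (no definition). IMPERFECT-`K` ROAD (res-L1-s46-pv-5's `W-WALK-PLAN.md`
§7.2 (c)): this is brick 3 (`…WWalkNRStepCore`) VERBATIM with `[PerfectField K₀]` DROPPED and the premise `π.Separable →` ADDED to each conclusion (used once, through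
brick 11's `exists_ringEquiv_chart_nr_of_separable`); names carry the suffix `_sep`. Brick 3 was the common child of this seat's gen-7
`…FormalNRStepCore.exists_ringEquiv_transform_seriesAnchor_nr` (purely inseparable residuals `F(u)`, NON-rational points) and
res-L1-s46-pv-5's `…WWalkStepCore.exists_ringEquiv_transform_wAnchor` (GENERAL residuals `f ∈ K⟦t,y,z⟧`, rational points).

WHAT. Data (pv-2's dictionary made non-rational, gen 7 brick 2): `g : R → L` local, Cohen coordinates `E₀ : R̂ ≅ K₀⟦t,y,z⟧` adapted to an
r.s.p. `c` to first order, the point in the chart `u_{i₀}` (`g(c_j) = g(c_{i₀}) e_j`) cut out by `𝔪_L = (g c_{i₀}, e_z, π̃^g(e_{u_{i₁}}))` with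
`π̃ ∈ R[X]` monic whose reduction `π ∈ K₀[X]` is irreducible AND SEPARABLE (`K₀` arbitrary), every element of `L` an `R`-polynomial in `e_{u_{i₁}}`
modulo `𝔪_L`, `dim L = 3`; a `w`-anchor `E₀(f₀) = w₀ · (z^p + f)` with `ord f ≥ p + 1`, and `g f₀ = g(c_{i₀})^p · f′`. THEN
(`exists_ringEquiv_transform_wAnchor_nr_sep`) there are Cohen coordinates `E′ : L̂ ≅ K′⟦t,y,z⟧`, `K′ = AdjoinRoot π = K₀(λ)`, and a unit `w′` with
`E′(f′) = w′ · G`, `X_{i₀}^p · G = (z^p + f^{K′})(Θ)` for the chart substitution `Θ` of the `K′`-RATIONAL point `(u_{i₀} ↦ u_{i₀}, u_{i₁} ↦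
u_{i₀}(u_{i₁} + λ), z ↦ u_{i₀} z)`; in the `t`-chart this is `E′(f′) = w′ · (z^p + chartT p λ f^{K′})` (`…_sep_T`), at the origin of the `y`-chart
(`π = X`) it is `w″ · (z^p + chartT p 0 (swapTY f^{K′}))` (`…_sep_V`, pv-5's swap). Here `f^{K′} = MvPowerSeries.map (K₀ → K′) f`.

HONEST FRAMING. OURS; NOT a statement of H. Hironaka's manuscript [Hironaka2017]; nothing of it is used. AI-written; AI review is weaker
than expert review. No `sorry`; axioms standard. [cite: Matsumura1987, Thm. 8.11], Thm. 28.3 / 29.7; [Hauser2010] §§F–G; [folklore].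
-/

noncomputable section

set_option linter.dupNamespace false -- mandated namespace of this single-conjunct summit

open IsLocalRing MvPowerSeries

namespace Summit.ResolutionOfSingularities.ResolutionOfSingularities.Theorems
namespace CampaignW46
namespace WWalkNR

open Literature.AlgebraicGeometry.Resolution
open WWalk
open MohWindowShadeFormalNR (ringHom_eq_subst_map_chartGerm eval_sub_eval_mem_of_coeff order_map_of_injective)
open CampaignW46.FormalChart
open CampaignW46.AtomGerm (hasSubst_chartGerm rename_chartSubst_self rename_chartSubst_of_ne exists_isUnit_image_adapted X_some_ne_zero
  mem_maximalIdeal_pow_iff_algebraMap subst_mem_pow_of_mem_maximalIdeal_pow)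
open Literature.RingTheory.MvPowerSeries.Jets (mem_maximalIdeal_iff_constantCoeff_eq_zero)
open Summit.ResolutionOfSingularities.ResolutionOfSingularities.Theorems.FrobeniusClosing (chartSubst)

section Transform

variable {p : ℕ} {K₀ : Type} [Field K₀]
  {R : Type} [CommRing R] [IsLocalRing R] [IsNoetherianRing R]
  {L : Type} [CommRing L] [IsLocalRing L] [IsNoetherianRing L]
  (g : R →+* L) (hg : (maximalIdeal R).map g ≤ maximalIdeal L)
  (E₀ : AdicCompletion (maximalIdeal R) R ≃+* MvPowerSeries (Option (Fin 2)) K₀)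
  (c : Option (Fin 2) → R) (hc : Ideal.span (Set.range c) = maximalIdeal R)
  (hcX : ∀ j, E₀ (algebraMap R (AdicCompletion (maximalIdeal R) R) (c j)) - X j ∈
    maximalIdeal (MvPowerSeries (Option (Fin 2)) K₀) ^ 2)
  {i₀ i₁ : Fin 2} (hi : i₁ ≠ i₀) (htwo : ∀ l, l = i₀ ∨ l = i₁)
  (e : Option (Fin 2) → L) (he : ∀ j, g (c j) = g (c (some i₀)) * e j)
  (πR : Polynomial R) (hπm : πR.Monic) (π : Polynomial K₀) [hπ : Fact (Irreducible π)]
  (hπR : πR.map ((MvPowerSeries.constantCoeff.comp (E₀ : _ →+* MvPowerSeries (Option (Fin 2)) K₀)).comp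
    (algebraMap R (AdicCompletion (maximalIdeal R) R))) = π)
  (hgen : Ideal.span {g (c (some i₀)), e none, (πR.map g).eval (e (some i₁))} = maximalIdeal L)
  (hres : ∀ y : L, ∃ P : Polynomial R, y - (P.map g).eval (e (some i₁)) ∈ maximalIdeal L)
  (hdim : ringKrullDim L = 3)

include hg hc he hcX hgen hres hdim hi htwo hπm hπR in
/-- [OURS · L1 W4.6 rung (iii-2) — THE RING-LEVEL `w`-STEP AT A NON-RATIONAL POINT; replaces the role of «the transform `E′` of `E` by the
blowup with center `D`» (H. Hironaka, ms. 2017, Def. 2.1 p.5) for a GENERAL window germ `z^p + f` at a NON-RATIONAL closed point of the point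
blow-up; NOT a statement of the manuscript] See the module docstring. [cite: Matsumura1987, Thm. 8.11] [cite: Hauser2010, §§F–G] -/
theorem exists_ringEquiv_transform_wAnchor_nr_sep (f : MvPowerSeries (Option (Fin 2)) K₀) (hfP2 : LowVanish (p + 1) f) (f₀ : R)
    (w₀ : MvPowerSeries (Option (Fin 2)) K₀) (hw₀ : IsUnit w₀)
    (hf₀ : E₀ (algebraMap R (AdicCompletion (maximalIdeal R) R) f₀) = w₀ * (X none ^ p + f))
    (f' : L) (hf' : g f₀ = g (c (some i₀)) ^ p * f') :
    π.Separable → ∃ (E' : AdicCompletion (maximalIdeal L) L ≃+* MvPowerSeries (Option (Fin 2)) (AdjoinRoot π))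
      (w' G : MvPowerSeries (Option (Fin 2)) (AdjoinRoot π)),
      IsUnit w' ∧ (∀ l : K₀, E' ((adicCompletionMap (maximalIdeal R) (maximalIdeal L) g hg) (E₀.symm (MvPowerSeries.C l))) =
        MvPowerSeries.C (AdjoinRoot.of π l)) ∧
      E' (algebraMap L (AdicCompletion (maximalIdeal L) L) f') = w' * G ∧
      X (some i₀) ^ p * G = subst (fun j : Option (Fin 2) => if j = some i₀ then (X (some i₀) : MvPowerSeries (Option (Fin 2)) (AdjoinRoot π))
        else X (some i₀) * (X j + MvPowerSeries.C (if j = none then 0 else AdjoinRoot.root π)))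
          (X none ^ p + MvPowerSeries.map (AdjoinRoot.of π) f) := by
  intro hsep
  classical
  set K' := AdjoinRoot π with hK'
  set ιK : K₀ →+* K' := AdjoinRoot.of π with hιK
  set ĝ := adicCompletionMap (maximalIdeal R) (maximalIdeal L) g hg with hĝ
  set φ : (MvPowerSeries (Option (Fin 2)) K₀) →+* AdicCompletion (maximalIdeal L) L := ĝ.comp E₀.symm.toRingHom with hφ
  set ofL := algebraMap L (AdicCompletion (maximalIdeal L) L) with hofL
  set ofR := algebraMap R (AdicCompletion (maximalIdeal R) R) with hofR
  set ev₀ : R →+* K₀ := (MvPowerSeries.constantCoeff.comp (E₀ : _ →+* MvPowerSeries (Option (Fin 2)) K₀)).comp ofR with hev₀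
  set v := ofL (g (c (some i₀))) with hv
  have hφE₀ : ∀ x, φ (E₀ x) = ĝ x := fun x => by
    rw [hφ, RingHom.comp_apply]; change ĝ (E₀.symm (E₀ x)) = ĝ x; rw [RingEquiv.symm_apply_apply]
  have hφapp : ∀ f, φ f = ĝ (E₀.symm f) := fun f => rfl
  have hĝ_of : ∀ x : R, ĝ (ofR x) = ofL (g x) := fun x => by rw [hofR, hofL, hĝ, adicCompletionMap_algebraMap]
  haveI : IsNoetherianRing (AdicCompletion (maximalIdeal L) L) := isNoetherianRing_adicCompletion_maximalIdeal L
  have h𝔪C : maximalIdeal (AdicCompletion (maximalIdeal L) L) = (maximalIdeal L).map ofL := AdicCompletion.maximalIdeal_eq_map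
  have hv𝔪 : v ∈ maximalIdeal (AdicCompletion (maximalIdeal L) L) := by
    rw [h𝔪C]
    exact Ideal.mem_map_of_mem _ (hg (Ideal.mem_map_of_mem _ (hc ▸ Ideal.subset_span ⟨some i₀, rfl⟩)))
  have hĝ𝔪 : ∀ {x}, x ∈ maximalIdeal (AdicCompletion (maximalIdeal R) R) → ĝ x ∈ Ideal.span {v} := fun hx =>
    map_maximalIdeal_completion_le g hg c hc (some i₀) e he (Ideal.mem_map_of_mem _ hx)
  have hφ𝔪 : ∀ {f : MvPowerSeries (Option (Fin 2)) K₀}, MvPowerSeries.constantCoeff f = 0 → φ f ∈ Ideal.span {v} := fun {f} hf => by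
    rw [hφapp]
    exact hĝ𝔪 (ringEquiv_mem_maximalIdeal E₀.symm (mem_maximalIdeal_iff_constantCoeff_eq_zero.mpr hf))
  have hcoef : ∀ r : R, ofL (g r) - φ (MvPowerSeries.C (ev₀ r)) ∈ Ideal.span {v} := fun r => by
    rw [← hĝ_of, ← hφE₀, ← map_sub]
    exact hφ𝔪 (by rw [map_sub, MvPowerSeries.constantCoeff_C, hev₀]; simp [hofR])
  -- second-order discrepancy of the variables
  have hX : ∀ j, ∃ b, φ (X j) = v * (ofL (e j) - v * b) := fun j => by
    have h2 : E₀.symm (E₀ (ofR (c j)) - X j) ∈ maximalIdeal (AdicCompletion (maximalIdeal R) R) ^ 2 :=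
      ringEquiv_mem_maximalIdeal_pow E₀.symm (hcX j)
    obtain ⟨b, hb⟩ := exists_eq_mul_of_mem_maximalIdeal_pow g hg c hc (some i₀) e he h2
    refine ⟨b, ?_⟩
    rw [map_sub, RingEquiv.symm_apply_apply, map_sub] at hb
    rw [hφapp, ← sub_sub_cancel (ĝ (ofR (c j))) (ĝ (E₀.symm (X j))), hb, hĝ_of, he j, map_mul, ← hv]
    ring
  have hXi : ∃ b, φ (X (some i₀)) = v * (1 - v * b) := by
    have h2 : E₀.symm (E₀ (ofR (c (some i₀))) - X (some i₀)) ∈ maximalIdeal (AdicCompletion (maximalIdeal R) R) ^ 2 :=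
      ringEquiv_mem_maximalIdeal_pow E₀.symm (hcX (some i₀))
    obtain ⟨b, hb⟩ := exists_eq_mul_of_mem_maximalIdeal_pow g hg c hc (some i₀) e he h2
    refine ⟨b, ?_⟩
    rw [map_sub, RingEquiv.symm_apply_apply, map_sub] at hb
    rw [hφapp, ← sub_sub_cancel (ĝ (ofR (c (some i₀)))) (ĝ (E₀.symm (X (some i₀)))), hb, hĝ_of, ← hv]
    ring
  choose bq hbq using hX
  obtain ⟨bi, hbi⟩ := hXi
  have hw : IsUnit (1 - v * bi) := IsLocalRing.isUnit_one_sub_self_of_mem_nonunits _ (Ideal.mul_mem_right _ _ hv𝔪)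
  set w := hw.unit with hw_def
  have hwval : (w : AdicCompletion (maximalIdeal L) L) = 1 - v * bi := by rw [hw_def, IsUnit.unit_spec]
  set e' : Option (Fin 2) → AdicCompletion (maximalIdeal L) L := fun j => (ofL (e j) - v * bq j) * (w⁻¹ : (AdicCompletion (maximalIdeal L) L)ˣ)
    with he'def
  have hww : (w : AdicCompletion (maximalIdeal L) L) * (w⁻¹ : (AdicCompletion (maximalIdeal L) L)ˣ) = 1 := Units.mul_inv w
  have he' : ∀ j, j ≠ some i₀ → φ (X j) = φ (X (some i₀)) * e' j := by
    intro j _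
    rw [hbq j, hbi, ← hwval, he'def]
    linear_combination (-(v * (ofL (e j) - v * bq j))) * hww
  have hv_eq : v = φ (X (some i₀)) * (w⁻¹ : (AdicCompletion (maximalIdeal L) L)ˣ) := by
    rw [hbi, ← hwval, mul_assoc, Units.mul_inv, mul_one]
  have he'_sub : ∀ j, e' j - ofL (e j) ∈ Ideal.span {v} := fun j => by
    have e1 : e' j - ofL (e j) = v * ((ofL (e j) * bi - bq j) * (w⁻¹ : (AdicCompletion (maximalIdeal L) L)ˣ)) := by
      rw [he'def]; linear_combination (ofL (e j)) * hww - (ofL (e j) * (w⁻¹ : (AdicCompletion (maximalIdeal L) L)ˣ)) * hwval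
    rw [e1]
    exact Ideal.mul_mem_right _ _ (Ideal.subset_span rfl)
  -- the two readings of the minimal polynomial
  set ιT : K₀ →+* AdicCompletion (maximalIdeal L) L := φ.comp MvPowerSeries.C with hιT
  have hπcoef : ∀ n, (πR.map (ofL.comp g)).coeff n - (π.map ιT).coeff n ∈ Ideal.span {v} := fun n => by
    rw [← hπR, Polynomial.map_map, Polynomial.coeff_map, Polynomial.coeff_map]
    exact hcoef _
  have hPcoef : ∀ (P : Polynomial R) n, (P.map (ofL.comp g)).coeff n - ((P.map ev₀).map ιT).coeff n ∈ Ideal.span {v} := fun P n => by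
    rw [Polynomial.map_map, Polynomial.coeff_map, Polynomial.coeff_map]
    exact hcoef _
  have hspan_v : Ideal.span {v} ≤ maximalIdeal (AdicCompletion (maximalIdeal L) L) := (Ideal.span_singleton_le_iff_mem _).2 hv𝔪
  have hofLeval : ∀ P : Polynomial R, ofL ((P.map g).eval (e (some i₁))) = (P.map (ofL.comp g)).eval (ofL (e (some i₁))) := fun P => by
    rw [Polynomial.eval_map, Polynomial.hom_eval₂, ← Polynomial.eval_map]
  have hgenC : Ideal.span {v, ofL (e none), (πR.map (ofL.comp g)).eval (ofL (e (some i₁)))} =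
      maximalIdeal (AdicCompletion (maximalIdeal L) L) := by
    have hmap := congrArg (Ideal.map ofL) hgen
    rw [Ideal.map_span, Set.image_insert_eq, Set.image_insert_eq, Set.image_singleton, hofLeval] at hmap
    rw [h𝔪C, ← hmap]
  have hgen' : Ideal.span {φ (X (some i₀)), e' none, (π.map ιT).eval (e' (some i₁))} =
      maximalIdeal (AdicCompletion (maximalIdeal L) L) := by
    rw [← hgenC]
    have hdiff : (πR.map (ofL.comp g)).eval (ofL (e (some i₁))) - (π.map ιT).eval (e' (some i₁)) ∈ Ideal.span {v} :=
      eval_sub_eval_mem_of_coeff hπcoef (by rw [← Ideal.neg_mem_iff, neg_sub]; exact he'_sub _)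
    apply le_antisymm
    · have hv_old : v ∈ Ideal.span {v, ofL (e none), (πR.map (ofL.comp g)).eval (ofL (e (some i₁)))} := Ideal.subset_span (by simp)
      have hsv : Ideal.span {v} ≤ Ideal.span {v, ofL (e none), (πR.map (ofL.comp g)).eval (ofL (e (some i₁)))} :=
        (Ideal.span_singleton_le_iff_mem _).2 hv_old
      rw [Ideal.span_le]
      rintro t ht
      simp only [Set.mem_insert_iff, Set.mem_singleton_iff] at ht
      rw [SetLike.mem_coe]
      rcases ht with rfl | rfl | rfl
      · rw [hbi]; exact Ideal.mul_mem_right _ _ hv_old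
      · have e1 : e' none = ofL (e none) + (e' none - ofL (e none)) := by ring
        rw [e1]
        exact Ideal.add_mem _ (Ideal.subset_span (by simp)) (hsv (he'_sub none))
      · have e1 : (π.map ιT).eval (e' (some i₁)) = (πR.map (ofL.comp g)).eval (ofL (e (some i₁))) -
            ((πR.map (ofL.comp g)).eval (ofL (e (some i₁))) - (π.map ιT).eval (e' (some i₁))) := by ring
        rw [e1]
        exact Ideal.sub_mem _ (Ideal.subset_span (by simp)) (hsv hdiff)
    · have hv_new : v ∈ Ideal.span {φ (X (some i₀)), e' none, (π.map ιT).eval (e' (some i₁))} := by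
        rw [hv_eq]; exact Ideal.mul_mem_right _ _ (Ideal.subset_span (by simp))
      have hsv : Ideal.span {v} ≤ Ideal.span {φ (X (some i₀)), e' none, (π.map ιT).eval (e' (some i₁))} :=
        (Ideal.span_singleton_le_iff_mem _).2 hv_new
      rw [Ideal.span_le]
      rintro t ht
      simp only [Set.mem_insert_iff, Set.mem_singleton_iff] at ht
      rw [SetLike.mem_coe]
      rcases ht with rfl | rfl | rfl
      · exact hv_new
      · have e1 : ofL (e none) = e' none - (e' none - ofL (e none)) := by ring
        rw [e1]
        exact Ideal.sub_mem _ (Ideal.subset_span (by simp)) (hsv (he'_sub none))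
      · have e1 : (πR.map (ofL.comp g)).eval (ofL (e (some i₁))) = (π.map ιT).eval (e' (some i₁)) +
            ((πR.map (ofL.comp g)).eval (ofL (e (some i₁))) - (π.map ιT).eval (e' (some i₁))) := by ring
        rw [e1]
        exact Ideal.add_mem _ (Ideal.subset_span (by simp)) (hsv hdiff)
  have hres' : ∀ x : AdicCompletion (maximalIdeal L) L, ∃ P : Polynomial K₀, x - (P.map ιT).eval (e' (some i₁)) ∈ maximalIdeal _ := by
    intro x
    obtain ⟨ybar, hybar⟩ := (AdicCompletion.residueField_map_bijective L).2 (IsLocalRing.residue _ x)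
    obtain ⟨y, rfl⟩ := IsLocalRing.residue_surjective ybar
    obtain ⟨P, hP⟩ := hres y
    refine ⟨P.map ev₀, ?_⟩
    have h1 : x - ofL y ∈ maximalIdeal _ := by
      rw [IsLocalRing.ResidueField.map_residue] at hybar
      rw [← Ideal.Quotient.eq]
      exact hybar.symm
    have h2 : ofL y - ofL ((P.map g).eval (e (some i₁))) ∈ maximalIdeal (AdicCompletion (maximalIdeal L) L) := by
      rw [← map_sub, h𝔪C]; exact Ideal.mem_map_of_mem _ hP
    have h3 : ofL ((P.map g).eval (e (some i₁))) - ((P.map ev₀).map ιT).eval (e' (some i₁)) ∈ maximalIdeal (AdicCompletion (maximalIdeal L) L) := by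
      rw [hofLeval]
      exact hspan_v (eval_sub_eval_mem_of_coeff (hPcoef P) (by rw [← Ideal.neg_mem_iff, neg_sub]; exact he'_sub _))
    have e3 : x - ((P.map ev₀).map ιT).eval (e' (some i₁)) = (x - ofL y) + (ofL y - ofL ((P.map g).eval (e (some i₁)))) +
        (ofL ((P.map g).eval (e (some i₁))) - ((P.map ev₀).map ιT).eval (e' (some i₁))) := by ring
    rw [e3]
    exact Ideal.add_mem _ (Ideal.add_mem _ h1 h2) h3
  have hdim' : ringKrullDim (AdicCompletion (maximalIdeal L) L) = 3 := by rw [ringKrullDim_adicCompletion]; exact hdim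
  have hπm' : π.Monic := by rw [← hπR]; exact hπm.map _
  -- STEP 1: the chart `E'` over `K′` (non-rational recognition, no shear)
  have hkill : subst (fun j : Option (Fin 2) => if j = none then (0 : MvPowerSeries (Option (Fin 2)) K') else X j)
      (0 : MvPowerSeries (Option (Fin 2)) K') = 0 := by
    have hk : HasSubst (fun j : Option (Fin 2) => if j = none then (0 : MvPowerSeries (Option (Fin 2)) K') else X j) :=
      hasSubst_of_constantCoeff_zero fun o => by by_cases ho : o = none <;> simp [ho]
    rw [← substAlgHom_apply hk, map_zero]
  obtain ⟨E', hE'C, hE'i, hE'j, hE'z⟩ :=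
    exists_ringEquiv_chart_nr_of_separable φ hi htwo e' he' π hπm' hsep hgen' hres' hdim' 0 (map_zero _) hkill
  set ψ : MvPowerSeries (Option (Fin 2)) K₀ →+* MvPowerSeries (Option (Fin 2)) K' := (E' : _ →+* MvPowerSeries (Option (Fin 2)) K').comp φ with hψ
  have hψapp : ∀ x, ψ x = E' (φ x) := fun x => rfl
  have hψC : ∀ l, ψ (MvPowerSeries.C l) = MvPowerSeries.C (ιK l) := fun l => hE'C l
  have hψi : ψ (X (some i₀)) = X (some i₀) := hE'i
  -- the chart substitution family of the `K′`-rational point `b`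
  set b : Fin 2 → K' := fun l => if l = i₀ then 0 else AdjoinRoot.root π with hb
  have hbi₁ : b i₁ = AdjoinRoot.root π := by rw [hb]; exact if_neg hi
  set Θ : Option (Fin 2) → MvPowerSeries (Option (Fin 2)) K' := fun j => if j = some i₀ then (X (some i₀) : MvPowerSeries (Option (Fin 2)) K')
    else X (some i₀) * (X j + MvPowerSeries.C (if j = none then 0 else AdjoinRoot.root π)) with hΘ
  have hΘeq : (fun o : Option (Fin 2) => o.elim (X (some i₀) * (X none + MvPowerSeries.rename (some : Fin 2 → Option (Fin 2)) (0 : MvPowerSeries (Fin 2) K')))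
      (fun j => MvPowerSeries.rename (some : Fin 2 → Option (Fin 2)) (chartSubst 2 K' i₀ b j))) = Θ := by
    funext o
    cases o with
    | none => rw [hΘ]; simp
    | some k =>
      by_cases hk : k = i₀
      · subst hk
        change MvPowerSeries.rename some (chartSubst 2 K' k b k) = _
        rw [rename_chartSubst_self, hΘ]; simp
      · change MvPowerSeries.rename some (chartSubst 2 K' i₀ b k) = _
        rw [rename_chartSubst_of_ne i₀ b hk, hΘ]
        have hk' : k = i₁ := by rcases htwo k with h | h; exact absurd h hk; exact h
        subst hk'
        simp [hk, hbi₁]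
  have hΘsub : HasSubst Θ := by rw [← hΘeq]; exact hasSubst_chartGerm i₀ b 0
  have hψj' : ∀ j : Fin 2, j ≠ i₀ → ψ (X (some j)) = X (some i₀) * (X (some j) + MvPowerSeries.C (b j)) := by
    intro j hj
    have hj' : j = i₁ := by rcases htwo j with h | h; exact absurd h hj; exact h
    subst hj'
    rw [hbi₁]; exact hE'j
  have hψz' : ψ (X none) = X (some i₀) * (X none + MvPowerSeries.rename (some : Fin 2 → Option (Fin 2)) (0 : MvPowerSeries (Fin 2) K')) := by
    rw [map_zero]; exact hE'z
  have hψsubst : ∀ h, ψ h = subst Θ (MvPowerSeries.map ιK h) := fun h => by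
    rw [← hΘeq]; exact ringHom_eq_subst_map_chartGerm ιK ψ hψC i₀ b 0 hψi hψj' hψz' h
  have hΘi : Θ (some i₀) = X (some i₀) := by rw [hΘ]; exact if_pos rfl
  have hΘmem : ∀ j, Θ j ∈ Ideal.span {(X (some i₀) : MvPowerSeries (Option (Fin 2)) K')} := by
    intro j
    by_cases hj : j = some i₀
    · rw [hj, hΘi]; exact Ideal.subset_span rfl
    · rw [hΘ]; simp only [if_neg hj]; exact Ideal.mul_mem_right _ _ (Ideal.subset_span rfl)
  -- STEP 2: `subst Θ f^{K′} = X_{i₀}^{p+1} · H`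
  set fK : MvPowerSeries (Option (Fin 2)) K' := MvPowerSeries.map ιK f with hfK
  have hfmem : fK ∈ maximalIdeal (MvPowerSeries (Option (Fin 2)) K') ^ (p + 1) :=
    (Literature.RingTheory.MvPowerSeries.Jets.mem_maximalIdeal_pow_iff).mpr ((lowVanish_map_iff ιK (p + 1) f).mpr hfP2)
  obtain ⟨H, hH⟩ : ∃ H : MvPowerSeries (Option (Fin 2)) K', subst Θ fK = X (some i₀) ^ (p + 1) * H := by
    have h := subst_mem_pow_of_mem_maximalIdeal_pow hΘsub hΘmem hfmem
    rw [Ideal.span_singleton_pow] at h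
    exact Ideal.mem_span_singleton'.1 h |>.imp fun H hH => by rw [← hH, mul_comm]
  set G₁ : MvPowerSeries (Option (Fin 2)) K' := X none ^ p + X (some i₀) * H with hG₁
  have hΘz : Θ none = X (some i₀) * X none := by rw [hΘ]; simp
  have hsubst_gen : subst Θ (X none ^ p + fK) = X (some i₀) ^ p * G₁ := by
    rw [subst_add hΘsub, subst_pow hΘsub, subst_X hΘsub, hΘz, hH, hG₁, mul_pow]; ring
  have hψzf : ψ (X none ^ p + f) = X (some i₀) ^ p * G₁ := by
    rw [hψsubst, map_add, map_pow, MvPowerSeries.map_X, ← hfK, hsubst_gen]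
  have hEgf₀ : E' (ofL (g f₀)) = ψ w₀ * (X (some i₀) ^ p * G₁) := by
    rw [← hĝ_of, ← hφE₀, ← hψapp, hf₀, map_mul, hψzf]
  -- STEP 3: `E′ (g c_{i₀}) = X_{i₀} · unit`
  obtain ⟨w₂, hw₂, hEci⟩ : ∃ w₂ : MvPowerSeries (Option (Fin 2)) K', IsUnit w₂ ∧ E' (ofL (g (c (some i₀)))) = X (some i₀) * w₂ := by
    have hcX' : MvPowerSeries.map ιK (E₀ (ofR (c (some i₀)))) - X (some i₀) ∈ maximalIdeal (MvPowerSeries (Option (Fin 2)) K') ^ 2 := by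
      have := hcX (some i₀)
      rw [← Literature.RingTheory.MvPowerSeries.Jets.le_order_iff_mem_maximalIdeal_pow] at this ⊢
      have e1 : MvPowerSeries.map ιK (E₀ (ofR (c (some i₀)))) - X (some i₀) = MvPowerSeries.map ιK (E₀ (ofR (c (some i₀))) - X (some i₀)) := by
        rw [map_sub, MvPowerSeries.map_X]
      rw [e1, order_map_of_injective ιK ιK.injective]
      exact this
    obtain ⟨w₂, hw₂, h⟩ := exists_isUnit_image_adapted i₀ hΘsub hΘi hΘmem (MvPowerSeries.map ιK (E₀ (ofR (c (some i₀))))) hcX'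
    exact ⟨w₂, hw₂, by rw [← hĝ_of, ← hφE₀, ← hψapp, hψsubst, h]⟩
  have hw₀' : IsUnit (ψ w₀) := hw₀.map ψ
  -- STEP 4: cancel `X_{i₀}^p`
  have hEf' : w₂ ^ p * E' (ofL f') = ψ w₀ * G₁ := by
    have h1 : E' (ofL (g f₀)) = (X (some i₀) * w₂) ^ p * E' (ofL f') := by
      rw [hf', map_mul, map_pow, map_mul, map_pow, hEci]
    have h2 : (X (some i₀) : MvPowerSeries (Option (Fin 2)) K') ^ p * (w₂ ^ p * E' (ofL f')) = X (some i₀) ^ p * (ψ w₀ * G₁) := by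
      rw [← mul_assoc, ← mul_pow, ← h1, hEgf₀]; ring
    exact mul_left_cancel₀ (pow_ne_zero p (X_some_ne_zero i₀)) h2
  obtain ⟨u₂, hu₂⟩ := hw₂.pow p
  refine ⟨E', ↑u₂⁻¹ * ψ w₀, G₁, (u₂⁻¹.isUnit).mul hw₀', fun l => hE'C l, ?_, ?_⟩
  · rw [mul_assoc, ← hEf', ← hu₂, ← mul_assoc, Units.inv_mul, one_mul]
  · rw [← hsubst_gen, hfK]

include hg hc he hcX hgen hres hdim hi htwo hπm hπR in
/-- **THE FORMAL `T`-STEP AT A NON-RATIONAL POINT** (chart `t = X (some 0)`): `E′(f′) = w′ · (z^p + chartT p λ f^{K′})` with `λ` the root of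
`π` in `K′ = K₀(λ)`. [cite: Matsumura1987, Thm. 8.11] [cite: Hauser2010, §§F–G] -/
theorem exists_ringEquiv_transform_wAnchor_nr_sep_T (hi₀ : i₀ = 0) (f : MvPowerSeries (Option (Fin 2)) K₀) (hfP2 : LowVanish (p + 1) f) (f₀ : R)
    (w₀ : MvPowerSeries (Option (Fin 2)) K₀) (hw₀ : IsUnit w₀)
    (hf₀ : E₀ (algebraMap R (AdicCompletion (maximalIdeal R) R) f₀) = w₀ * (X none ^ p + f))
    (f' : L) (hf' : g f₀ = g (c (some i₀)) ^ p * f') :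
    π.Separable → ∃ (E' : AdicCompletion (maximalIdeal L) L ≃+* MvPowerSeries (Option (Fin 2)) (AdjoinRoot π))
      (w' : MvPowerSeries (Option (Fin 2)) (AdjoinRoot π)),
      IsUnit w' ∧ (∀ l : K₀, E' ((adicCompletionMap (maximalIdeal R) (maximalIdeal L) g hg) (E₀.symm (MvPowerSeries.C l))) =
        MvPowerSeries.C (AdjoinRoot.of π l)) ∧
      E' (algebraMap L (AdicCompletion (maximalIdeal L) L) f') =
        w' * (X none ^ p + chartT p (AdjoinRoot.root π) (MvPowerSeries.map (AdjoinRoot.of π) f)) := by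
  intro hsep
  subst hi₀
  obtain ⟨E', w', G, hw', hC, hE', hG⟩ :=
    exists_ringEquiv_transform_wAnchor_nr_sep g hg E₀ c hc hcX hi htwo e he πR hπm π hπR hgen hres hdim f hfP2 f₀ w₀ hw₀ hf₀ f' hf' hsep
  have hfam : (fun j : Option (Fin 2) => if j = some (0 : Fin 2) then (X (some 0) : MvPowerSeries (Option (Fin 2)) (AdjoinRoot π))
      else X (some 0) * (X j + MvPowerSeries.C (if j = none then 0 else AdjoinRoot.root π))) = thetaT (AdjoinRoot.root π) := by
    funext j
    rcases j with _ | k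
    · simp
    · fin_cases k
      · simp
      · simp
  have hlow : LowVanish p (MvPowerSeries.map (AdjoinRoot.of π) f) :=
    fun e he => (lowVanish_map_iff (AdjoinRoot.of π) (p + 1) f).mpr hfP2 e (by omega)
  rw [hfam, subst_thetaT_generator (AdjoinRoot.root π) hlow] at hG
  refine ⟨E', w', hw', hC, ?_⟩
  rw [hE', mul_left_cancel₀ (pow_ne_zero p (X_some_ne_zero (0 : Fin 2))) hG]

include hg hc he hcX hgen hres hdim hi htwo hπm hπR in
/-- **THE FORMAL `V`-STEP AT THE ORIGIN OF THE `y`-CHART** (`i₀ = 1`, `π = X`: the sharp-vertical direction, a point residually rational over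
its image but with ANY coefficient field `K₀` downstairs): after pv-5's swap of the Cohen coordinates,
`E″(f′) = w″ · (z^p + chartT p 0 (swapTY f^{K′}))`, `K′ = AdjoinRoot X`. [cite: Matsumura1987, Thm. 8.11] [cite: Hauser2010, §§F–G] -/
theorem exists_ringEquiv_transform_wAnchor_nr_sep_V (hi₀ : i₀ = 1) (hHW : π = Polynomial.X) (f : MvPowerSeries (Option (Fin 2)) K₀)
    (hfP2 : LowVanish (p + 1) f) (f₀ : R) (w₀ : MvPowerSeries (Option (Fin 2)) K₀) (hw₀ : IsUnit w₀)
    (hf₀ : E₀ (algebraMap R (AdicCompletion (maximalIdeal R) R) f₀) = w₀ * (X none ^ p + f))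
    (f' : L) (hf' : g f₀ = g (c (some i₀)) ^ p * f') :
    π.Separable → ∃ (E' : AdicCompletion (maximalIdeal L) L ≃+* MvPowerSeries (Option (Fin 2)) (AdjoinRoot π))
      (w' : MvPowerSeries (Option (Fin 2)) (AdjoinRoot π)),
      IsUnit w' ∧ (∀ l : K₀, E' ((adicCompletionMap (maximalIdeal R) (maximalIdeal L) g hg) (E₀.symm (MvPowerSeries.C l))) =
        MvPowerSeries.C (AdjoinRoot.of π l)) ∧
      E' (algebraMap L (AdicCompletion (maximalIdeal L) L) f') =
        w' * (X none ^ p + chartT p (0 : AdjoinRoot π) (swapTY (MvPowerSeries.map (AdjoinRoot.of π) f))) := by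
  intro hsep
  subst hi₀
  obtain ⟨E', w', G, hw', hC, hE', hG⟩ :=
    exists_ringEquiv_transform_wAnchor_nr_sep g hg E₀ c hc hcX hi htwo e he πR hπm π hπR hgen hres hdim f hfP2 f₀ w₀ hw₀ hf₀ f' hf' hsep
  have hroot : AdjoinRoot.root π = 0 := by
    rw [← AdjoinRoot.mk_X]
    have h2 : AdjoinRoot.mk π Polynomial.X = AdjoinRoot.mk π π := congrArg (fun q => AdjoinRoot.mk π q) hHW.symm
    rw [h2]
    exact AdjoinRoot.mk_self
  have hfam : (fun j : Option (Fin 2) => if j = some (1 : Fin 2) then (X (some 1) : MvPowerSeries (Option (Fin 2)) (AdjoinRoot π))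
      else X (some 1) * (X j + MvPowerSeries.C (if j = none then 0 else AdjoinRoot.root π))) =
      (fun j : Option (Fin 2) => if j = some (1 : Fin 2) then (X (some 1) : MvPowerSeries (Option (Fin 2)) (AdjoinRoot π))
        else X (some 1) * (X j + MvPowerSeries.C 0)) := by
    funext j
    rcases j with _ | k
    · simp
    · fin_cases k
      · simp [hroot]
      · simp
  set fK := MvPowerSeries.map (AdjoinRoot.of π) f with hfK
  have hlowK : LowVanish (p + 1) fK := (lowVanish_map_iff (AdjoinRoot.of π) (p + 1) f).mpr hfP2
  have hsw : LowVanish p (swapTY fK) := lowVanish_swapTY fun e he => hlowK e (by omega)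
  rw [hfam, subst_yChart_eq_swap, ← subst_swapS_eq (X none ^ p + fK), subst_add hasSubst_swapS, subst_pow hasSubst_swapS,
    subst_X hasSubst_swapS, swapS_none, subst_swapS_eq, subst_thetaT_generator (0 : AdjoinRoot π) hsw, ← subst_swapS_eq,
    subst_mul hasSubst_swapS, subst_pow hasSubst_swapS, subst_X hasSubst_swapS, swapS_zero] at hG
  have hGeq : G = subst swapS (X none ^ p + chartT p 0 (swapTY fK)) :=
    mul_left_cancel₀ (pow_ne_zero p (X_some_ne_zero (1 : Fin 2))) hG
  refine ⟨E'.trans swapEquiv.toRingEquiv, swapEquiv w', hw'.map _, fun l => ?_, ?_⟩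
  · rw [RingEquiv.trans_apply, hC]
    change swapEquiv (MvPowerSeries.C (AdjoinRoot.of π l)) = _
    rw [swapEquiv_apply, ← subst_swapS_eq, subst_C]
  · rw [RingEquiv.trans_apply, hE']
    change swapEquiv (w' * G) = _
    rw [map_mul, hGeq, swapEquiv_apply (subst swapS _), subst_swapS_eq, swapTY_swapTY]

end Transform

end WWalkNR
end CampaignW46
end Summit.ResolutionOfSingularities.ResolutionOfSingularities.Theorems

end
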